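import Summits.BirchSwinnertonDyer.BirchSwinnertonDyer.Theorems.SignedLowerHalvesSmallImageLowerHalfBothSignsRttCharRoadE2HKOfRoadD
import Summits.BirchSwinnertonDyer.BirchSwinnertonDyer.Theorems.SignedLowerHalvesSmallImageLowerHalfBothSignsRttCharRoadE2JunctionShaSocket
import Summits.BirchSwinnertonDyer.BirchSwinnertonDyer.Theorems.SignedLowerHalvesSmallImageLowerHalfBothSignsRttCharRoadE2JunctionIndex
import HarnessLib

/-!
# Route `SignedLowerHalves`, crux L `SmallImageLowerHalfBothSigns` (stmt-BirchSwinnertonDyer-23599), line `rtt_w3` v14 — E2, THE DEPLETED JUNCTION (RULING (F1)):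
# the glue's `hK` from road D through a junction whose exactness carrier is the S₀K-STRICT sub-carrier `B' ↪ B` and whose element is the
# S₀-DEPLETED class `w'`, `ι w' = E • sp¹ ζ̄` (E = Π Euler factors)

WHY (-w3 g22 J3 DESIGN NOTE 2026-08-30T19:23Z (F1), LEAD RULING same day). `Dψ`'s signed Selmer group is S₀K-RELAXED (Kim's non-primitive group), so by Poitou–Tate the
carrier mapping onto `ker gX` is `B' := ker(B → Π_{w∈S₀K} 𝐇¹(K_{∞,w},T*))`, not the full `B = 𝐇¹_{Iw,Σ}(K_∞,T*)` that receives `sp¹`; the zeta class enters through its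
depletion `E • sp¹ ζ̄ ∈ ι(B')`. THIS FILE re-derives p780454's `lambdaInvariant_quotient_span_le_of_roadD_junction` in that shape:
`λ(H ⧸ ∙j w') ≤ λ(B' ⧸ ∙w') = λ(B ⧸ ∙E•sζ̄) − λ(B ⧸ range ι) ≤ λ(B ⧸ range s) + λ(Hsp ⧸ ∙ζ̄) + λ(Λ_𝒪 ⧸ (E)) − λ(B ⧸ range ι) ≤ λ(H2[f]) + λ((H1⧸Z)/f) + λ(Λ_𝒪⧸(E)) − λ(B⧸range ι)
= λ(H2/f) + λ(Λ_𝒪⧸(E)) − λ(B⧸range ι) ≤ λ(Y)` — the last step is the NEW J4 target `hY : λ(H2/f) + λ(Λ_𝒪⧸(E)) ≤ λ(Y) + λ(B⧸range ι)` (true for `Y = coker gX` by Poitou–Tate: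
`λ(coker gX) = λ(Sel_str^∨) + Σ_{S₀K} λ(H¹_w(M)^∨) − λ(B⧸B')`, `λ(Λ_𝒪⧸(Π Euler)) = Σ λ(H¹_w(M)^∨)`, `λ(Sel_str^∨) ≥ λ(Ш²) = λ(H2/f)`). Tools: the index identity
`lambdaInvariant_quotient_span_add_ker_eq` (p777767) three times (for `ι`, for `j`, and through `lambdaInvariant_quotient_span_le_add_of_junction` with `j = id` for `s`),
additivity `lambdaInvariant_eq_add_of_surjective`, `lambdaInvariant_range_le` (p782347), road D in equality form (p778649) and the swap `λ(Hsp⧸∙ζ̄) = λ((H1⧸Z)/f)` (p780454).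

* `isTorsion_quotient_span_of_isTorsion_quotient_range` — `B ⧸ ∙(s z')` is `Λ`-torsion when `B ⧸ range s` and `H' ⧸ ∙z'` are;
* `isTorsion_quotient_span_smul` — `B ⧸ ∙(E • x)` is `Λ`-torsion when `B ⧸ ∙x` is (`E ≠ 0`);
* `lambdaInvariant_quotient_span_smul_le` — `λ(B ⧸ ∙(E • x)) ≤ λ(Λ_𝒪 ⧸ (E)) + λ(B ⧸ ∙x)`;
* ★★★ `lambdaInvariant_quotient_span_le_of_roadD_junction_depleted` — the glue's `hK` in the depleted shape.

THEOREMS ONLY (`--supports stmt-BirchSwinnertonDyer-23599` helper); closes nothing; crux L, crux M, E2 and BSD remain OPEN and are proved for NO curve by any of this.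
[cite: Kobayashi2003, Thm. 7.3 i)] [cite: GreenbergVatsal2000, §2 Prop. (2.4) and p. 44 (non-primitive Selmer groups, δ_v)] [cite: BDKim2009, Cor. 2.5, Prop. 2.6]
[cite: JohnsonLeungKings2011, Thm. 5.2, Cor. 5.3] [cite: Washington1997, §13.2]
-/

set_option autoImplicit false
-- the Theorems namespace of this sub repeats the summit name by design (D-0017 nested layout)
set_option linter.dupNamespace false

noncomputable section
open scoped Pointwise Classical MatrixGroups ModularForm

open PowerSeries Literature.NumberTheory.Automorphic Literature.NumberTheory.EllipticCurves Literature.NumberTheory.EllipticCurves.Module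
open Literature.NumberTheory.ComplexMultiplication.EllipticUnits.JohnsonLeungKings2011
open Summit.BirchSwinnertonDyer.BirchSwinnertonDyer.Theorems.SignedBaseChangeAcDivSpecialization.LocalLength (isPrincipal_charIdeal_of_ufm)
open Summit.BirchSwinnertonDyer.BirchSwinnertonDyer.Theorems.SmallImageRttD2LamSpec
open Summit.BirchSwinnertonDyer.Rank1Residual.X2.DualRestrictionInvariants (lambdaInvariant_eq_add_of_surjective)
open Literature.NumberTheory.IwasawaTheory Literature.NumberTheory.EllipticCurves.GreenbergVatsal2000 CongruenceSubgroup NumberField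
  IsDedekindDomain Rat.HeightOneSpectrum Literature.NumberTheory.EllipticCurves.ModularForms

namespace Summit.BirchSwinnertonDyer.BirchSwinnertonDyer.Theorems.SmallImageRttCharRoad

universe u v w w' w''

/-! ## §1 Torsion and λ bookkeeping for cyclic quotients -/

section Bookkeeping

variable {p : ℕ} [Fact p.Prime] {S : Set (PadicAlgCl p)} [Algebra (IwasawaAlgebra p) (IwasawaAlgebraO S)]
  {B : Type w} [AddCommGroup B] [Module (IwasawaAlgebraO S) B] [Module (IwasawaAlgebra p) B] [IsScalarTower (IwasawaAlgebra p) (IwasawaAlgebraO S) B]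
  {H' : Type v} [AddCommGroup H'] [Module (IwasawaAlgebraO S) H'] [Module (IwasawaAlgebra p) H'] [IsScalarTower (IwasawaAlgebra p) (IwasawaAlgebraO S) H']

/-- `B ⧸ Λ_𝒪∙(s z')` is `Λ`-torsion when `B ⧸ range s` and `H' ⧸ Λ_𝒪∙z'` are. [folklore] -/
theorem isTorsion_quotient_span_of_isTorsion_quotient_range (s : H' →ₗ[IwasawaAlgebraO S] B) (z' : H')
    (htB : Module.IsTorsion (IwasawaAlgebra p) (B ⧸ LinearMap.range s))
    (ht' : Module.IsTorsion (IwasawaAlgebra p) (H' ⧸ Submodule.span (IwasawaAlgebraO S) {z'})) :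
    Module.IsTorsion (IwasawaAlgebra p) (B ⧸ Submodule.span (IwasawaAlgebraO S) {s z'}) := by
  intro x
  obtain ⟨b, rfl⟩ := Submodule.Quotient.mk_surjective _ x
  obtain ⟨⟨a, ha⟩, hab⟩ := @htB (Submodule.Quotient.mk b)
  rw [Submonoid.mk_smul, ← Submodule.Quotient.mk_smul, Submodule.Quotient.mk_eq_zero] at hab
  obtain ⟨y, hy⟩ := LinearMap.mem_range.mp hab
  obtain ⟨⟨c, hc⟩, hcy⟩ := @ht' (Submodule.Quotient.mk y)
  rw [Submonoid.mk_smul, ← Submodule.Quotient.mk_smul, Submodule.Quotient.mk_eq_zero, Submodule.mem_span_singleton] at hcy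
  obtain ⟨l, hl⟩ := hcy
  refine ⟨⟨c * a, mul_mem hc ha⟩, ?_⟩
  rw [Submonoid.mk_smul, ← Submodule.Quotient.mk_smul, Submodule.Quotient.mk_eq_zero, Submodule.mem_span_singleton]
  refine ⟨l, ?_⟩
  calc l • s z' = s (l • z') := (map_smul s l z').symm
    _ = s (c • y) := by rw [hl]
    _ = c • s y := LinearMap.map_smul_of_tower s c y
    _ = (c * a) • b := by rw [hy, mul_smul]

/-- `B ⧸ Λ_𝒪∙(E • x)` is `Λ`-torsion when `B ⧸ Λ_𝒪∙x` is and `E ≠ 0`. [folklore] -/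
theorem isTorsion_quotient_span_smul (halg : ∀ r : IwasawaAlgebra p, algebraMap (IwasawaAlgebra p) (IwasawaAlgebraO S) r = iwasawaToIwasawaO S r)
    [FiniteDimensional ℚ_[p] (padicCoeffField S)] (x : B) {E : IwasawaAlgebraO S} (hE : E ≠ 0)
    (ht : Module.IsTorsion (IwasawaAlgebra p) (B ⧸ Submodule.span (IwasawaAlgebraO S) {x})) :
    Module.IsTorsion (IwasawaAlgebra p) (B ⧸ Submodule.span (IwasawaAlgebraO S) {E • x}) := by
  haveI := moduleFinite_iwasawaAlgebraO S halg
  -- a non-zero `d ∈ Λ` with `algebraMap d = q * E` (`Λ_𝒪` is integral over `Λ`)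
  have hint : IsIntegral (IwasawaAlgebra p) E := IsIntegral.of_finite (IwasawaAlgebra p) E
  have hne : (Ideal.span {E}).comap (algebraMap (IwasawaAlgebra p) (IwasawaAlgebraO S)) ≠ ⊥ :=
    Ideal.comap_ne_bot_of_integral_mem hE (Ideal.mem_span_singleton_self E) hint
  obtain ⟨d, hd, hd0⟩ := Submodule.exists_mem_ne_zero_of_ne_bot hne
  obtain ⟨q, hq'⟩ := Ideal.mem_span_singleton'.mp (Ideal.mem_comap.mp hd)
  intro y
  obtain ⟨b, rfl⟩ := Submodule.Quotient.mk_surjective _ y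
  obtain ⟨⟨a, ha⟩, hab⟩ := @ht (Submodule.Quotient.mk b)
  rw [Submonoid.mk_smul, ← Submodule.Quotient.mk_smul, Submodule.Quotient.mk_eq_zero, Submodule.mem_span_singleton] at hab
  obtain ⟨l, hl⟩ := hab
  refine ⟨⟨d * a, mul_mem (mem_nonZeroDivisors_of_ne_zero hd0) ha⟩, ?_⟩
  rw [Submonoid.mk_smul, ← Submodule.Quotient.mk_smul, Submodule.Quotient.mk_eq_zero, Submodule.mem_span_singleton]
  refine ⟨l * q, ?_⟩
  rw [mul_smul d a b, ← hl, ← IsScalarTower.algebraMap_smul (IwasawaAlgebraO S) d (l • x), ← hq', mul_smul, mul_smul,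
    smul_comm l q (E • x), smul_comm l E x]

/-- **`λ(B ⧸ Λ_𝒪∙(E • x)) ≤ λ(Λ_𝒪 ⧸ (E)) + λ(B ⧸ Λ_𝒪∙x)`**: the kernel of `B ⧸ ∙E•x ↠ B ⧸ ∙x` is `∙x ⧸ ∙E•x`, a quotient of `Λ_𝒪 ⧸ (E)` via `l ↦ l • x`.
[cite: Washington1997, §13.2] [folklore] -/
theorem lambdaInvariant_quotient_span_smul_le (halg : ∀ r : IwasawaAlgebra p, algebraMap (IwasawaAlgebra p) (IwasawaAlgebraO S) r = iwasawaToIwasawaO S r)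
    [FiniteDimensional ℚ_[p] (padicCoeffField S)] [Module.Finite (IwasawaAlgebra p) B] (x : B) {E : IwasawaAlgebraO S} (hE : E ≠ 0)
    (ht : Module.IsTorsion (IwasawaAlgebra p) (B ⧸ Submodule.span (IwasawaAlgebraO S) {x})) :
    lambdaInvariant p (B ⧸ Submodule.span (IwasawaAlgebraO S) {E • x}) ≤
      lambdaInvariant p (IwasawaAlgebraO S ⧸ Ideal.span {E}) + lambdaInvariant p (B ⧸ Submodule.span (IwasawaAlgebraO S) {x}) := by
  haveI := moduleFinite_iwasawaAlgebraO S halg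
  have hle : Submodule.span (IwasawaAlgebraO S) {E • x} ≤ Submodule.span (IwasawaAlgebraO S) {x} := by
    rw [Submodule.span_singleton_le_iff_mem]
    exact Submodule.smul_mem _ _ (Submodule.mem_span_singleton_self x)
  -- the surjection `π : B ⧸ ∙E•x ↠ B ⧸ ∙x`
  let π : (B ⧸ Submodule.span (IwasawaAlgebraO S) {E • x}) →ₗ[IwasawaAlgebraO S] (B ⧸ Submodule.span (IwasawaAlgebraO S) {x}) :=
    Submodule.mapQ _ _ LinearMap.id hle
  have hπ : Function.Surjective (π.restrictScalars (IwasawaAlgebra p)) := by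
    intro y
    obtain ⟨b, rfl⟩ := Submodule.Quotient.mk_surjective _ y
    exact ⟨Submodule.Quotient.mk b, rfl⟩
  have htE := isTorsion_quotient_span_smul halg x hE ht
  have h1 := lambdaInvariant_eq_add_of_surjective p (π.restrictScalars (IwasawaAlgebra p)) htE hπ
  -- `Λ_𝒪 ⧸ (E) ↠ ker π`, `l ↦ l • x`
  let f : IwasawaAlgebraO S →ₗ[IwasawaAlgebraO S] (B ⧸ Submodule.span (IwasawaAlgebraO S) {E • x}) :=
    (Submodule.mkQ _) ∘ₗ LinearMap.toSpanSingleton (IwasawaAlgebraO S) B x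
  have hf : Ideal.span {E} ≤ LinearMap.ker f := by
    rw [Ideal.span_le, Set.singleton_subset_iff, SetLike.mem_coe, LinearMap.mem_ker]
    change Submodule.Quotient.mk (E • x) = 0
    rw [Submodule.Quotient.mk_eq_zero]
    exact Submodule.mem_span_singleton_self _
  let g : (IwasawaAlgebraO S ⧸ Ideal.span {E}) →ₗ[IwasawaAlgebra p] (B ⧸ Submodule.span (IwasawaAlgebraO S) {E • x}) :=
    (Submodule.liftQ (Ideal.span {E}) f hf).restrictScalars (IwasawaAlgebra p)
  have hrange : LinearMap.range g = LinearMap.ker (π.restrictScalars (IwasawaAlgebra p)) := by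
    apply le_antisymm
    · rintro _ ⟨y, rfl⟩
      obtain ⟨l, rfl⟩ := Ideal.Quotient.mk_surjective y
      rw [LinearMap.mem_ker]
      change π (f l) = 0
      change Submodule.Quotient.mk (LinearMap.id (l • x)) = (0 : B ⧸ Submodule.span (IwasawaAlgebraO S) {x})
      rw [LinearMap.id_apply, Submodule.Quotient.mk_eq_zero]
      exact Submodule.smul_mem _ _ (Submodule.mem_span_singleton_self x)
    · intro y hy
      obtain ⟨b, rfl⟩ := Submodule.Quotient.mk_surjective _ y
      rw [LinearMap.mem_ker] at hy
      change Submodule.Quotient.mk (LinearMap.id b) = (0 : B ⧸ Submodule.span (IwasawaAlgebraO S) {x}) at hy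
      rw [LinearMap.id_apply, Submodule.Quotient.mk_eq_zero, Submodule.mem_span_singleton] at hy
      obtain ⟨l, rfl⟩ := hy
      exact ⟨Ideal.Quotient.mk _ l, rfl⟩
  have hqt : Module.IsTorsion (IwasawaAlgebra p) (IwasawaAlgebraO S ⧸ Ideal.span {E}) := by
    refine isTorsion_of_isTorsion_iwasawaAlgebraO p S halg _ fun y ↦ ⟨⟨E, mem_nonZeroDivisors_of_ne_zero hE⟩, ?_⟩
    obtain ⟨y, rfl⟩ := Submodule.Quotient.mk_surjective _ y
    rw [Submonoid.mk_smul, ← Submodule.Quotient.mk_smul, Submodule.Quotient.mk_eq_zero, smul_eq_mul]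
    exact Ideal.mul_mem_right _ _ (Ideal.mem_span_singleton_self E)
  haveI : Module.Finite (IwasawaAlgebra p) (IwasawaAlgebraO S ⧸ Ideal.span {E}) :=
    moduleFinite_of_moduleFinite_iwasawaAlgebraO p S halg _
  have h2 : lambdaInvariant p (LinearMap.ker (π.restrictScalars (IwasawaAlgebra p))) ≤ lambdaInvariant p (IwasawaAlgebraO S ⧸ Ideal.span {E}) := by
    rw [← hrange]
    exact lambdaInvariant_range_le g hqt
  omega

end Bookkeeping

/-! ## §2 The depleted junction -/

section Depleted

variable (p : ℕ) [Fact p.Prime] (S : Set (PadicAlgCl p)) [FiniteDimensional ℚ_[p] (padicCoeffField S)]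
  (b : padicCoeffIntegers S) (φ : PowerSeries (IwasawaAlgebraO S) →+* IwasawaAlgebraO S)
  (hφf : φ (C (X - C b)) = 0) (hC : ∀ a : padicCoeffIntegers S, φ (C (C a)) = C a) (hX : φ X = X)
  (hker : RingHom.ker φ = Ideal.span {C (X - C b)})

include hφf hC hX hker in
/-- ★★★ **The glue's `hK` from road D through the DEPLETED junction.** Road-D frame as in `lambdaInvariant_quotient_span_le_of_roadD_junction` (p780454); junction:
the full carrier `B` (f.g. over `Λ`) receiving `s = sp¹ : Hsp → B` with `B ⧸ range s` torsion and `λ(B ⧸ range s) ≤ λ(H2[f])`; an injective `ι : B' → B` (the S₀K-strict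
sub-carrier), a depletion `E ≠ 0` in `Λ_𝒪` and `w' ∈ B'` with `ι w' = E • s ζ̄`; `j : B' ↠ H` (in E2: Poitou–Tate onto `ker gX`); `z := j w'` with `l • z = 0 ⇒ l • ζ̄ = 0`
and `H ⧸ ∙z` f.g. torsion; and `hY : λ(H2/f) + λ(Λ_𝒪 ⧸ (E)) ≤ λ(Y) + λ(B ⧸ range ι)`. Then `λ(H ⧸ Λ_𝒪∙z) ≤ λ(Y)`.
[cite: Kobayashi2003, Thm. 7.3 i)] [cite: GreenbergVatsal2000, §2 Prop. (2.4)] [cite: JohnsonLeungKings2011, Thm. 5.2, Cor. 5.3] [cite: Washington1997, §13.2] -/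
theorem lambdaInvariant_quotient_span_le_of_roadD_junction_depleted {Aidx H0 H1 H2 : Type v} [AddCommGroup H0]
    [Module (PowerSeries (IwasawaAlgebraO S)) H0] [AddCommGroup H1] [Module (PowerSeries (IwasawaAlgebraO S)) H1] [AddCommGroup H2]
    [Module (PowerSeries (IwasawaAlgebraO S)) H2] [Module.Finite (PowerSeries (IwasawaAlgebraO S)) H1]
    [Module.Finite (PowerSeries (IwasawaAlgebraO S)) H2]
    (D : ZetaSkeleton (PowerSeries (IwasawaAlgebraO S)) Aidx H0 H1 H2) (h52 : D.Thm52Shape)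
    (hreg : ¬ charIdeal (PowerSeries (IwasawaAlgebraO S)) H2 ≤ Ideal.span {(C (X - C b) : PowerSeries (IwasawaAlgebraO S))})
    (hdef : Submodule.torsionBy (PowerSeries (IwasawaAlgebraO S)) (H1 ⧸ D.Z) (C (X - C b)) = ⊥)
    -- `Hsp` with the D2-seq structures
    [Module (IwasawaAlgebraO S) (QuotSMulTop (C (X - C b) : PowerSeries (IwasawaAlgebraO S)) H1)]
    (hιH : ∀ (l : IwasawaAlgebraO S) (x : QuotSMulTop (C (X - C b) : PowerSeries (IwasawaAlgebraO S)) H1),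
      l • x = (PowerSeries.map (PowerSeries.C : padicCoeffIntegers S →+* IwasawaAlgebraO S) l) • x)
    [Algebra (IwasawaAlgebra p) (IwasawaAlgebraO S)]
    (halg : ∀ r : IwasawaAlgebra p, algebraMap (IwasawaAlgebra p) (IwasawaAlgebraO S) r = iwasawaToIwasawaO S r)
    [Module (IwasawaAlgebra p) (QuotSMulTop (C (X - C b) : PowerSeries (IwasawaAlgebraO S)) H1)]
    [IsScalarTower (IwasawaAlgebra p) (IwasawaAlgebraO S) (QuotSMulTop (C (X - C b) : PowerSeries (IwasawaAlgebraO S)) H1)]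
    -- pinned `Λ`-structures on `H2[f]` and `Ysp = H2/f`
    [Module (IwasawaAlgebra p) (Submodule.torsionBy (PowerSeries (IwasawaAlgebraO S)) H2 (C (X - C b)))]
    (hΛT : ∀ (r : IwasawaAlgebra p) (x : Submodule.torsionBy (PowerSeries (IwasawaAlgebraO S)) H2 (C (X - C b))),
      r • x = (PowerSeries.map (PowerSeries.C : padicCoeffIntegers S →+* IwasawaAlgebraO S) (iwasawaToIwasawaO S r)) • x)
    [Module (IwasawaAlgebra p) (QuotSMulTop (C (X - C b) : PowerSeries (IwasawaAlgebraO S)) H2)]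
    (hΛ2 : ∀ (r : IwasawaAlgebra p) (x : QuotSMulTop (C (X - C b) : PowerSeries (IwasawaAlgebraO S)) H2),
      r • x = (PowerSeries.map (PowerSeries.C : padicCoeffIntegers S →+* IwasawaAlgebraO S) (iwasawaToIwasawaO S r)) • x)
    -- the cyclic specialised zeta module
    (ζ : QuotSMulTop (C (X - C b) : PowerSeries (IwasawaAlgebraO S)) H1)
    (hζ : (D.Z).map ((C (X - C b) : PowerSeries (IwasawaAlgebraO S)) • (⊤ : Submodule (PowerSeries (IwasawaAlgebraO S)) H1)).mkQ =
      Submodule.span (PowerSeries (IwasawaAlgebraO S)) {ζ})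
    -- the DEPLETED junction (RULING (F1)): full carrier `B` with `s = sp¹`, strict sub-carrier `ι : B' ↪ B`, depletion `E`, `w'` with `ι w' = E • s ζ`
    {B : Type w} {B' : Type w''} {H : Type w'} [AddCommGroup B] [Module (IwasawaAlgebraO S) B] [Module (IwasawaAlgebra p) B]
    [IsScalarTower (IwasawaAlgebra p) (IwasawaAlgebraO S) B] [Module.Finite (IwasawaAlgebra p) B]
    [AddCommGroup B'] [Module (IwasawaAlgebraO S) B'] [Module (IwasawaAlgebra p) B'] [IsScalarTower (IwasawaAlgebra p) (IwasawaAlgebraO S) B']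
    [AddCommGroup H] [Module (IwasawaAlgebraO S) H] [Module (IwasawaAlgebra p) H] [IsScalarTower (IwasawaAlgebra p) (IwasawaAlgebraO S) H]
    (s : QuotSMulTop (C (X - C b) : PowerSeries (IwasawaAlgebraO S)) H1 →ₗ[IwasawaAlgebraO S] B)
    (htB : Module.IsTorsion (IwasawaAlgebra p) (B ⧸ LinearMap.range s))
    (hcoker : lambdaInvariant p (B ⧸ LinearMap.range s) ≤ lambdaInvariant p (Submodule.torsionBy (PowerSeries (IwasawaAlgebraO S)) H2 (C (X - C b))))
    (ι : B' →ₗ[IwasawaAlgebraO S] B) (hι : Function.Injective ι) (E : IwasawaAlgebraO S) (hE : E ≠ 0)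
    (w' : B') (hw' : ι w' = E • s ζ)
    (j : B' →ₗ[IwasawaAlgebraO S] H) (hj : Function.Surjective j)
    (hmeet : ∀ l : IwasawaAlgebraO S, l • j w' = 0 → l • ζ = 0)
    [Module.Finite (IwasawaAlgebra p) (H ⧸ Submodule.span (IwasawaAlgebraO S) {j w'})]
    (ht : Module.IsTorsion (IwasawaAlgebra p) (H ⧸ Submodule.span (IwasawaAlgebraO S) {j w'}))
    {Y : Type*} [AddCommGroup Y] [Module (IwasawaAlgebra p) Y]
    (hY : lambdaInvariant p (QuotSMulTop (C (X - C b) : PowerSeries (IwasawaAlgebraO S)) H2) +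
        lambdaInvariant p (IwasawaAlgebraO S ⧸ Ideal.span {E}) ≤
      lambdaInvariant p Y + lambdaInvariant p (B ⧸ LinearMap.range ι)) :
    lambdaInvariant p (H ⧸ Submodule.span (IwasawaAlgebraO S) {j w'}) ≤ lambdaInvariant p Y := by
  haveI : UniqueFactorizationMonoid (PowerSeries (IwasawaAlgebraO S)) := by
    haveI : IsDiscreteValuationRing (padicCoeffIntegers S) := by
      rw [padicCoeffIntegers_eq_unitBall S]; exact LambdaLowerBoundO.isDiscreteValuationRing_unitBall p _
    exact Literature.NumberTheory.IwasawaTheory.uniqueFactorizationMonoid_powerSeries_powerSeries (padicCoeffIntegers S)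
  haveI := moduleFinite_iwasawaAlgebraO S halg
  letI iΛ : Module (IwasawaAlgebra p) (QuotSMulTop (C (X - C b) : PowerSeries (IwasawaAlgebraO S)) (H1 ⧸ D.Z)) :=
    Module.compHom _ ((PowerSeries.map (PowerSeries.C : padicCoeffIntegers S →+* IwasawaAlgebraO S)).comp (iwasawaToIwasawaO S))
  -- road D in equality form (defect-free)
  have hD := lambdaInvariant_quotSMulTop_add_torsionBy_eq_of_thm52Shape_of_torsionBy_eq_bot p S b φ hφf hC hX hker D h52 hreg hdef
    (fun _ _ ↦ rfl) hΛT hΛ2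
  obtain ⟨⟨-, -, htorsA, -⟩, hchar⟩ := h52
  obtain ⟨tA, htA, htA0⟩ := Submodule.annihilator_top_inter_nonZeroDivisors htorsA
  have htA' : ∀ m : H1 ⧸ D.Z, tA • m = 0 := fun m ↦ Submodule.mem_annihilator.mp htA m Submodule.mem_top
  obtain ⟨g, hg⟩ := (isPrincipal_charIdeal_of_ufm (R := PowerSeries (IwasawaAlgebraO S)) (M := H2)).principal
  have hgA : charIdeal (PowerSeries (IwasawaAlgebraO S)) (H1 ⧸ D.Z) = Ideal.span {g} := by
    rw [show charIdeal (PowerSeries (IwasawaAlgebraO S)) (H1 ⧸ D.Z) = charIdeal (PowerSeries (IwasawaAlgebraO S)) H2 from hchar]; exact hg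
  have hg0 : φ g ≠ 0 := by
    intro h0; apply hreg; rw [show charIdeal (PowerSeries (IwasawaAlgebraO S)) H2 = Ideal.span {g} from hg, Ideal.span_singleton_le_iff_mem, ← hker]; exact h0
  -- `λ(Hsp ⧸ Λ_𝒪∙ζ̄) = λ((H1 ⧸ Z)/f)`, f.g. torsion over `Λ`
  obtain ⟨hlam, hfin', htor'⟩ := lambdaInvariant_quotient_span_singleton_eq_quotSMulTop_quotient p S b φ hφf hC hX hker D.Z
    (nonZeroDivisors.ne_zero htA0) htA' hgA hg0 hιH halg ζ hζ
  haveI := hfin'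
  -- (D) `λ(B ⧸ ∙sζ̄) ≤ λ(Hsp ⧸ ∙ζ̄) + λ(B ⧸ range s)` (junction with `j = id`)
  have hmeet_s : ∀ l : IwasawaAlgebraO S, l • s ζ = 0 → l • ζ = 0 := fun l hl ↦ by
    apply hmeet
    have h1 : ι (l • w') = 0 := by rw [map_smul, hw', smul_comm, hl, smul_zero]
    have h2 : l • w' = 0 := hι (by rw [h1, map_zero])
    rw [← map_smul, h2, map_zero]
  have htBs : Module.IsTorsion (IwasawaAlgebra p) (B ⧸ Submodule.span (IwasawaAlgebraO S) {s ζ}) :=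
    isTorsion_quotient_span_of_isTorsion_quotient_range s ζ htB htor'
  have hDstep := lambdaInvariant_quotient_span_le_add_of_junction s LinearMap.id Function.surjective_id ζ (s ζ) rfl hmeet_s htor' htBs htB
  -- (C) `λ(B ⧸ ∙E•sζ̄) ≤ λ(Λ_𝒪 ⧸ (E)) + λ(B ⧸ ∙sζ̄)`
  have hCstep := lambdaInvariant_quotient_span_smul_le (B := B) halg (s ζ) hE htBs
  have htBE : Module.IsTorsion (IwasawaAlgebra p) (B ⧸ Submodule.span (IwasawaAlgebraO S) {E • s ζ}) :=
    isTorsion_quotient_span_smul halg (s ζ) hE htBs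
  -- (B) `λ(B ⧸ ∙E•sζ̄) = λ(B' ⧸ ∙w') + λ(B ⧸ range ι)` (index identity for `ι`, `ker ι = 0`)
  haveI : Module.Finite (IwasawaAlgebra p) B' := Module.Finite.of_injective (ι.restrictScalars (IwasawaAlgebra p)) hι
  have htB' : Module.IsTorsion (IwasawaAlgebra p) (B' ⧸ Submodule.span (IwasawaAlgebraO S) {w'}) := by
    intro y
    obtain ⟨c, rfl⟩ := Submodule.Quotient.mk_surjective _ y
    obtain ⟨⟨a, ha⟩, hac⟩ := @htBE (Submodule.Quotient.mk (ι c))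
    rw [Submonoid.mk_smul, ← Submodule.Quotient.mk_smul, Submodule.Quotient.mk_eq_zero, Submodule.mem_span_singleton] at hac
    obtain ⟨l, hl⟩ := hac
    refine ⟨⟨a, ha⟩, ?_⟩
    rw [Submonoid.mk_smul, ← Submodule.Quotient.mk_smul, Submodule.Quotient.mk_eq_zero, Submodule.mem_span_singleton]
    refine ⟨l, hι ?_⟩
    rw [map_smul, hw', hl, LinearMap.map_smul_of_tower]
  have hBstep := lambdaInvariant_quotient_span_add_ker_eq ι w' (E • s ζ) hw' (fun l hl ↦ hι (by
      rw [map_smul, hw', hl, map_zero])) htB' htBE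
  have hkerι : lambdaInvariant p (LinearMap.ker (ι.restrictScalars (IwasawaAlgebra p))) = 0 := by
    haveI : Subsingleton (LinearMap.ker (ι.restrictScalars (IwasawaAlgebra p))) :=
      ⟨fun a b ↦ Subtype.ext (hι (by rw [show ι a.1 = 0 from a.2, show ι b.1 = 0 from b.2]))⟩
    exact lambdaInvariant_eq_zero_of_subsingleton p _
  -- (A) `λ(H ⧸ ∙z) ≤ λ(B' ⧸ ∙w')` (index identity for `j`, `range j = ⊤`)
  have hAstep := lambdaInvariant_quotient_span_add_ker_eq j w' (j w') rfl (fun l hl ↦ by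
      have := hmeet l hl
      -- `l • ζ = 0 ⇒ l • s ζ = 0 ⇒ l • E s ζ = 0 = ι (l • w') ⇒ l • w' = 0`
      apply hι
      rw [map_smul, hw', smul_comm, ← map_smul, this, map_zero, smul_zero, map_zero]) htB' ht
  have hrangej : lambdaInvariant p (H ⧸ LinearMap.range j) = 0 := by
    haveI : Subsingleton (H ⧸ LinearMap.range j) := by
      refine ⟨fun a b ↦ ?_⟩
      obtain ⟨x, rfl⟩ := Submodule.Quotient.mk_surjective _ a
      obtain ⟨y, rfl⟩ := Submodule.Quotient.mk_surjective _ b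
      rw [Submodule.Quotient.eq, LinearMap.range_eq_top.mpr hj]
      exact Submodule.mem_top
    exact lambdaInvariant_eq_zero_of_subsingleton p _
  -- assemble
  rw [hlam] at hDstep
  have hcoker' := hcoker
  have hDsum : lambdaInvariant p (QuotSMulTop (C (X - C b) : PowerSeries (IwasawaAlgebraO S)) (H1 ⧸ D.Z)) +
      lambdaInvariant p (Submodule.torsionBy (PowerSeries (IwasawaAlgebraO S)) H2 (C (X - C b))) =
      lambdaInvariant p (QuotSMulTop (C (X - C b) : PowerSeries (IwasawaAlgebraO S)) H2) := hD
  omega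

end Depleted

end Summit.BirchSwinnertonDyer.BirchSwinnertonDyer.Theorems.SmallImageRttCharRoad

end
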